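import Summits.Ventures.ResidMod.Mod3SurjectiveCertificate
import Summits.Ventures.ResidMod.EulerFactorDualFrame
import Summits.Ventures.ResidMod.TateFrames
import Literature.NumberTheory.DiophantineGeometry.Bcgp2025ModThreeSurjectiveModular
import Literature.NumberTheory.DiophantineGeometry.BcgpSwitchExistsModularAbelianSurfaceProofs
import Literature.NumberTheory.GaloisRepresentations.PhiGammaModuleReindex
import Literature.NumberTheory.FaltingsSerre.ResidualFrobeniusData
import HarnessLib

/-!
# Venture ResidMod — the MOD-3 flag (surjective image): the verdict from the ACCEPTED named fact
# (Boxer–Calegari–Gee–Pilloni 2025, Thm. 1.1.1), and the Frobenius polynomial at `2` from `L₂(A,T)`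

HONEST FRAMING. Interface file of a COMPUTATION cell (`pub-residmod`); companion of
`Mod3SurjectiveCertificate.lean`. NO surface is claimed modular here and NO image is computed. The
cited theorem is the tree's named fact
`Literature.NumberTheory.DiophantineGeometry.bcgp2025_modThreeSurjective_modular_abelianSurface`
(BCGP 2025 = arXiv:2502.20645, Thm. 1.1.1, typed as printed by the cell's LIT seat), taken as the
hypothesis `h111`; in print it rests on Arthur's classification for `GSp₄` (loc. cit. §1.6). Every
datum about a surface is a binder (the certificate `C : Mod3SurjectiveCertificate A` and the two
extra slots below).

WHAT IS HERE.
* `modular_of_mod3SurjectiveCertificate_of_bcgp2025` — the ADAPTER (cell PLAN R11, P2-1): certificate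
  `C` + the surjectivity slot in the fact's own shape (`hsurj`: a non-degenerate alternating `J` for
  which `ρ̄ = C.rho` is symplectic with multiplier `ε̄⁻¹` and EVERY similitude of `J` is some `ρ̄(σ)` —
  the verdict `SURJECTIVE` of the cell's offline checker; the structure's `card_range = 103680` is not
  used: turning it into surjectivity would need `|GSp₄(𝔽₃)| = 103680` as a Lean theorem, which the
  tree does not have) + separability of `L₃(A,T)` over `ℚ` (`hsepL`, the slot DIST0(3) in
  `T`-form, kernel-checked per curve by a Bézout pair) ⟹ every framed dual of every `V_p(A)` is
  `IsAutomorphicAE`. The frame slot is transported by `ρ₀ := C.rho^∨` (`FramedRep.coe_dual_apply`,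
  `FramedRep.dual_dual`); hypothesis (3b) of the fact ("the characteristic polynomial of Frobenius at `3`
  does not have repeated roots", typed as: every framed dual of `V_ℓ(A)`, `ℓ ≠ 3`, unramified at `v ∣ 3`
  with separable Frobenius polynomials) is DERIVED from `C.euler_three` and `hsepL` by bridge B3
  (`separable_dualFrame_of_hasGoodEulerFactorAt`, `EulerFactorDualFrame.lean`).
* `frobCharpoly_rho_of_eulerData_two` — KERNEL LINK for the slot F2OK: if `L₂(A,T) = 1 − aT + bT² −
  2aT³ + 4T⁴` (`HasGoodEulerFactorAt 2`) and `ρ̄` carries a contragredient torsion frame of `A[3]`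
  (slot TORS3), then every Frobenius polynomial of `ρ̄` at `v ∣ 2` is `X⁴ + āX³ + b̄X² + 2āX + 1`
  (`ā, b̄ = a, b mod 3`): Serre–Tate `T₃/3 = A[3]` (tree: `bcgp_switch_charpolyClause_of_dualTorsionFrame`)
  composed with `TateFrames.hasFrobCharpolyAt_dualFrame_of_hasGoodEulerFactorAt` at `p = 2, ℓ = 3` (`4 ≡ 1 mod 3` renormalises the reciprocal
  polynomial). Consequently (`frobCharpoly_two_ne_of_eulerData`) F2OK holds as soon as
  `¬ (b ≡ 2 ∧ a ≢ 0 (mod 3))` — the classes `4C/12C` have polynomials `(X² ± X + 2)² =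
  X⁴ ∓ … ≡ X⁴ + 2X³ + 2X² + X + 1`, `X⁴ + X³ + 2X² + 2X + 1 (mod 3)`.

References: [BoxerCalegariGeePilloni2025] arXiv:2502.20645 Thm. 1.1.1, Lemma 9.1.3 (classes 4C/12C and
their polynomials), §1.8 (conventions), §10.1; [BrumerEtAl2019] (4.1.5); [SerreTate1968] §1.
-/

noncomputable section

namespace Summit.Ventures.ResidMod

open CategoryTheory IsDedekindDomain Field Polynomial Matrix
open scoped NumberField
open Literature.NumberTheory.GaloisRepresentations Literature.NumberTheory.Automorphic
open Literature.NumberTheory.Automorphic.Paramodular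
open Literature.NumberTheory.DiophantineGeometry Literature.NumberTheory.FaltingsSerre
open Literature.AlgebraicGeometry.Motives (AbelianVariety)

variable {A : AbelianVariety ℚ}

/-! ## A. The Frobenius polynomial of `ρ̄_{A,3}` at `2` from `L₂(A,T)` (slot F2OK) -/

/-- The polynomial `X⁴ + xX³ + yX² + 2xX + 1` over `𝔽₃` has `X³`-coefficient `x`. [folklore] -/
theorem coeff_three_frobPolyTwo (x y : ZMod 3) :
    (X ^ 4 + C x * X ^ 3 + C y * X ^ 2 + C (2 * x) * X + 1 : Polynomial (ZMod 3)).coeff 3 = x := by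
  simp [coeff_one]

/-- The polynomial `X⁴ + xX³ + yX² + 2xX + 1` over `𝔽₃` has `X²`-coefficient `y`. [folklore] -/
theorem coeff_two_frobPolyTwo (x y : ZMod 3) :
    (X ^ 4 + C x * X ^ 3 + C y * X ^ 2 + C (2 * x) * X + 1 : Polynomial (ZMod 3)).coeff 2 = y := by
  simp [coeff_one]

/-- `(X² + X + 2)² = X⁴ + 2X³ + 2X² + X + 1` over `𝔽₃` (class `4C/12C`, first sign). [cite: BoxerCalegariGeePilloni2025, Lemma 9.1.3] -/
theorem sq_quadratic_pos_eq :
    ((X ^ 2 + X + 2) ^ 2 : Polynomial (ZMod 3)) = X ^ 4 + C 2 * X ^ 3 + C 2 * X ^ 2 + C (2 * 2) * X + 1 := by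
  have h3 : (3 : Polynomial (ZMod 3)) = 0 := by
    have := CharP.cast_eq_zero (Polynomial (ZMod 3)) 3; simpa using this
  simp only [map_ofNat, map_mul]
  linear_combination (X ^ 2 + 1) * h3

/-- `(X² − X + 2)² = X⁴ + X³ + 2X² + 2X + 1` over `𝔽₃` (class `4C/12C`, second sign). [cite: BoxerCalegariGeePilloni2025, Lemma 9.1.3] -/
theorem sq_quadratic_neg_eq :
    ((X ^ 2 - X + 2) ^ 2 : Polynomial (ZMod 3)) = X ^ 4 + C 1 * X ^ 3 + C 2 * X ^ 2 + C (2 * 1) * X + 1 := by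
  have h3 : (3 : Polynomial (ZMod 3)) = 0 := by
    have := CharP.cast_eq_zero (Polynomial (ZMod 3)) 3; simpa using this
  simp only [map_ofNat, map_one, mul_one]
  linear_combination (-X ^ 3 + X ^ 2 - 2 * X + 1) * h3

/-- `L₂(A,T) = 1 − aT + bT² − 2aT³ + 4T⁴` reduced mod `3` is `X⁴ + āX³ + b̄X² + 2āX + 1` up to the
order of terms (`4 ≡ 1`, `−2a ≡ a`, `−a ≡ 2a`). [cite: BrumerEtAl2019, (4.1.5) p. 1164] -/
theorem map_lPolynomialOfSurface_two_zmod_three (a b : ℤ) :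
    (lPolynomialOfSurface 2 a b).map (Int.castRingHom (ZMod 3)) =
      X ^ 4 + C ((a : ℤ) : ZMod 3) * X ^ 3 + C ((b : ℤ) : ZMod 3) * X ^ 2 +
        C (2 * ((a : ℤ) : ZMod 3)) * X + 1 := by
  have e2 : ∀ x : ZMod 3, -x = 2 * x := by decide
  have e3 : ∀ x : ZMod 3, -(2 * x) = x := by decide
  have e4 : (4 : ZMod 3) = 1 := by decide
  ext n
  rw [coeff_map, eq_intCast]
  simp only [coeff_add, coeff_C_mul, coeff_X_pow, coeff_X, coeff_one]
  rcases n with _ | _ | _ | _ | _ | n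
  · rw [lPolynomialOfSurface_coeff_zero]; simp
  · rw [coeff_lPolynomialOfSurface_one]; push_cast; simp [e2]
  · rw [coeff_lPolynomialOfSurface_two]; simp
  · rw [coeff_lPolynomialOfSurface_three]; push_cast; simp [e3]
  · rw [coeff_lPolynomialOfSurface_four]; push_cast; simp; exact e4
  · rw [coeff_eq_zero_of_natDegree_lt
      (lt_of_le_of_lt (natDegree_lPolynomialOfSurface_le 2 a b) (by omega))]
    simp [show n + 1 + 1 + 1 + 1 + 1 ≠ 4 by omega]

/-- **F2OK, kernel link: the Frobenius polynomial of `ρ̄_{A,3}` at `2` is `L₂(A,T) mod 3`, made monic.**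
For an abelian surface `A/ℚ`, a framed `ρ̄ : Γ_ℚ → GL₄(𝔽₃)` with a contragredient torsion frame of
`A[3]` (slot TORS3: `e₃ (g • P) = ρ̄(g⁻¹)ᵀ e₃ P`, i.e. `ρ̄` is `ρ̄_{A,3}` on `A[3]^∨`), and the good Euler
factor `L₂(A,T) = 1 − aT + bT² − 2aT³ + 4T⁴` at `2`: every Frobenius polynomial of `ρ̄` at `v ∣ 2` is
`X⁴ + āX³ + b̄X² + 2āX + 1`, `ā = a mod 3`, `b̄ = b mod 3` (the arithmetic Frobenius on `A[3]^∨` has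
the inverse eigenvalues; `T₃/3 = A[3]`, Serre–Tate). [cite: BoxerCalegariGeePilloni2025, §1.8 and Lemma 9.1.3] [cite: SerreTate1968, §1] -/
theorem frobCharpoly_rho_of_eulerData_two (hA : A.dim = 2) {ρb : FramedGaloisRep ℚ (ZMod 3) 4}
    (hframe : ∃ e₃ : A.geomTorsion (3 : ℕ) ≃+ (Fin 4 → ZMod 3),
      ∀ (g : absoluteGaloisGroup ℚ) (P : A.geomTorsion (3 : ℕ)),
        e₃ (g • P) = ((ρb g⁻¹ : GL (Fin 4) (ZMod 3)) : Matrix (Fin 4) (Fin 4) (ZMod 3))ᵀ *ᵥ e₃ P)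
    {a b : ℤ} (hL : A.HasGoodEulerFactorAt 2 ((lPolynomialOfSurface 2 a b).map (Int.castRingHom ℚ)))
    {v : HeightOneSpectrum (𝓞 ℚ)} (hv : ((2 : ℕ) : 𝓞 ℚ) ∈ v.asIdeal) {Q : Polynomial (ZMod 3)}
    (hQ : ρb.HasFrobCharpolyAt v Q) :
    Q = X ^ 4 + C ((a : ℤ) : ZMod 3) * X ^ 3 + C ((b : ℤ) : ZMod 3) * X ^ 2 +
      C (2 * ((a : ℤ) : ZMod 3)) * X + 1 := by
  obtain ⟨e₃, he₃⟩ := hframe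
  obtain ⟨b₃⟩ := nonempty_basis_rationalTateModule hA 3
  -- the framed dual `r(g) = [g⁻¹]ᵀ ⊗ ℚ̄₃` of `V₃(A)`
  set r : FramedGaloisRep ℚ (PadicAlgCl 3) 4 :=
    FramedRep.baseChange (algebraMap ℚ_[3] (PadicAlgCl 3)) (continuous_algebraMap_padicAlgCl 3)
      (FramedRep.dual ((A.rationalTateGaloisRep 3
        (A.continuous_rationalTateRep_holds 3 (by norm_num))).frame b₃)) with hrdef
  have hr : ∀ g : absoluteGaloisGroup ℚ, (r g).val =
      ((LinearMap.toMatrix b₃ b₃ (A.rationalTateRep 3 g⁻¹)).map (algebraMap ℚ_[3] (PadicAlgCl 3))).transpose := by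
    intro g
    rw [hrdef, ← Matrix.transpose_map]
    rfl
  -- Frobenius at `v`
  obtain ⟨𝔓, h𝔓⟩ := HeightOneSpectrum.primesAbove_nonempty v
  obtain ⟨σ, hσ⟩ := HeightOneSpectrum.exists_isArithFrobAt_of_mem_primesAbove_holds h𝔓
  have hQσ : FramedRep.charpoly ρb σ = Q := hQ 𝔓 h𝔓 σ hσ
  -- `charpoly r σ = C (1/4) · L₂(X)` (`TateFrames`, at `p = 2`, `ℓ = 3`)
  set L : ℚ[X] := (lPolynomialOfSurface 2 a b).map (Int.castRingHom ℚ) with hLdef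
  have hL0 : L.coeff 0 ≠ 0 := coeff_zero_lPolynomialOfSurface_map_ne_zero 2 a b
  have hlc : L.leadingCoeff = 4 := by
    rw [hLdef, Polynomial.leadingCoeff, natDegree_map_eq_of_injective (Int.castRingHom ℚ).injective_int,
      natDegree_lPolynomialOfSurface two_ne_zero, coeff_map, coeff_lPolynomialOfSurface_four]
    norm_num
  have hrσ : FramedRep.charpoly r σ =
      C ((algebraMap ℚ (PadicAlgCl 3) 4)⁻¹) * L.map (algebraMap ℚ (PadicAlgCl 3)) := by
    rw [← hlc]
    exact hasFrobCharpolyAt_dualFrame_of_hasGoodEulerFactorAt hL hL0 (ℓ := 3) (by decide) b₃ r hr hv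
      𝔓 h𝔓 σ hσ
  -- Serre–Tate: an integral polynomial mapping to both
  obtain ⟨P, hP, hPbar⟩ := bcgp_switch_charpolyClause_of_dualTorsionFrame A hA ρb e₃ he₃ b₃ r hr σ
  -- `C 4 * P = L₂` in `ℤ₃[X]` (injectivity of `ℤ₃ → ℚ̄₃`)
  have hinj : Function.Injective (algebraMap ℤ_[3] (PadicAlgCl 3)) := by
    rw [IsScalarTower.algebraMap_eq ℤ_[3] ℚ_[3] (PadicAlgCl 3)]
    exact (algebraMap ℚ_[3] (PadicAlgCl 3)).injective.comp (IsFractionRing.injective ℤ_[3] ℚ_[3])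
  have h4 : (algebraMap ℚ (PadicAlgCl 3) 4) ≠ 0 := by norm_num
  have h44 : algebraMap ℤ_[3] (PadicAlgCl 3) 4 * (algebraMap ℚ (PadicAlgCl 3) 4)⁻¹ = 1 := by
    rw [map_ofNat, ← map_ofNat (algebraMap ℚ (PadicAlgCl 3)) 4, mul_inv_cancel₀ h4]
  have hPL : C (4 : ℤ_[3]) * P = (lPolynomialOfSurface 2 a b).map (Int.castRingHom ℤ_[3]) := by
    apply Polynomial.map_injective _ hinj
    rw [Polynomial.map_mul, map_C, hP, hrσ, ← mul_assoc, ← C_mul, h44, C_1, one_mul, hLdef,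
      map_map_intCast (Int.castRingHom ℚ) (algebraMap ℚ (PadicAlgCl 3))
        ((algebraMap ℤ_[3] (PadicAlgCl 3)).comp (Int.castRingHom ℤ_[3])),
      ← Polynomial.map_map]
  -- reduce mod `3`: `4 ≡ 1`
  have hred := congrArg (Polynomial.map (PadicInt.toZMod (p := 3))) hPL
  rw [Polynomial.map_mul, map_C, hPbar, hQσ, map_ofNat, show (4 : ZMod 3) = 1 from rfl, C_1, one_mul,
    map_map_intCast (Int.castRingHom ℤ_[3]) (PadicInt.toZMod (p := 3)) (Int.castRingHom (ZMod 3))] at hred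
  rw [hred, map_lPolynomialOfSurface_two_zmod_three]

/-- **Slot F2OK from the Euler factor at `2`** (numeric discharge): under the hypotheses of
`frobCharpoly_rho_of_eulerData_two`, if NOT (`b ≡ 2` and `a ≢ 0 (mod 3)`) then no Frobenius polynomial
of `ρ̄` at `v ∣ 2` is `(X² ± X + 2)²` (the classes `4C/12C` of Lemma 9.1.3, whose polynomials mod `3`
are `X⁴ + 2X³ + 2X² + X + 1` and `X⁴ + X³ + 2X² + 2X + 1`: compare the `X³`- and `X²`-coefficients).
[cite: BoxerCalegariGeePilloni2025, Thm. 1.1.1 (2) and Lemma 9.1.3] -/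
theorem frobCharpoly_two_ne_of_eulerData (hA : A.dim = 2) {ρb : FramedGaloisRep ℚ (ZMod 3) 4}
    (hframe : ∃ e₃ : A.geomTorsion (3 : ℕ) ≃+ (Fin 4 → ZMod 3),
      ∀ (g : absoluteGaloisGroup ℚ) (P : A.geomTorsion (3 : ℕ)),
        e₃ (g • P) = ((ρb g⁻¹ : GL (Fin 4) (ZMod 3)) : Matrix (Fin 4) (Fin 4) (ZMod 3))ᵀ *ᵥ e₃ P)
    {a b : ℤ} (hL : A.HasGoodEulerFactorAt 2 ((lPolynomialOfSurface 2 a b).map (Int.castRingHom ℚ)))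
    (hab : ¬ (((b : ℤ) : ZMod 3) = 2 ∧ ((a : ℤ) : ZMod 3) ≠ 0)) :
    ∀ v : HeightOneSpectrum (𝓞 ℚ), ((2 : ℕ) : 𝓞 ℚ) ∈ v.asIdeal →
      ∀ Q : Polynomial (ZMod 3), ρb.HasFrobCharpolyAt v Q →
        Q ≠ (X ^ 2 + X + 2) ^ 2 ∧ Q ≠ (X ^ 2 - X + 2) ^ 2 := by
  intro v hv Q hQ
  rw [frobCharpoly_rho_of_eulerData_two hA hframe hL hv hQ, sq_quadratic_pos_eq, sq_quadratic_neg_eq]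
  generalize ((a : ℤ) : ZMod 3) = x at hab ⊢
  generalize ((b : ℤ) : ZMod 3) = y at hab ⊢
  constructor
  · intro h
    have h3 := congrArg (fun T : Polynomial (ZMod 3) => T.coeff 3) h
    have h2 := congrArg (fun T : Polynomial (ZMod 3) => T.coeff 2) h
    simp only [coeff_three_frobPolyTwo, coeff_two_frobPolyTwo] at h3 h2
    exact hab ⟨h2, by rw [h3]; decide⟩
  · intro h
    have h3 := congrArg (fun T : Polynomial (ZMod 3) => T.coeff 3) h
    have h2 := congrArg (fun T : Polynomial (ZMod 3) => T.coeff 2) h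
    simp only [coeff_three_frobPolyTwo, coeff_two_frobPolyTwo] at h3 h2
    exact hab ⟨h2, by rw [h3]; decide⟩

/-! ## B. The verdict from the accepted named fact -/

/-- **VERDICT (mod-3 flag, surjective image), from the tree's named fact.**  An abelian surface
`A/ℚ` with a certificate `C : Mod3SurjectiveCertificate A` whose surjectivity is given in the shape of
the fact (`hsurj`: for some non-degenerate alternating `J`, `ρ̄ = C.rho` is symplectic with multiplier
`ε̄⁻¹` and every similitude of `J` over `𝔽₃` is a value of `ρ̄` — verdict SURJECTIVE of the offline
checker) and whose Euler factor `L₃(A,T)` is separable over `ℚ` (`hsepL`, slot DIST0(3), a Bézout pair)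
is modular in the tree's almost-everywhere `GL₄` sense, GIVEN BCGP 2025 Thm. 1.1.1 (`h111`, the
accepted named fact). Hypothesis (3b) of the fact is derived by bridge B3; the frame is transported to
the fact's `(ρ₀, e, ρb = ρ₀^∨)` shape with `ρ₀ = ρ̄^∨`. CONDITIONAL on `h111`; every datum a binder.
[cite: BoxerCalegariGeePilloni2025, Thm. 1.1.1; §9.5 (End(A_ℚ̄) = ℤ automatic); §1.8] -/
theorem modular_of_mod3SurjectiveCertificate_of_bcgp2025
    (h111 : bcgp2025_modThreeSurjective_modular_abelianSurface)
    (A : AbelianVariety ℚ) (hA : A.dim = 2) (C : Mod3SurjectiveCertificate A)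
    (hsurj : ∃ J : Matrix (Fin 4) (Fin 4) (ZMod 3), Jᵀ = -J ∧ IsUnit J.det ∧
      (∀ σ : absoluteGaloisGroup ℚ,
        (C.rho σ).valᵀ * J * (C.rho σ).val =
          (((modPCyclotomicCharacterZMod ℚ 3 σ)⁻¹ : (ZMod 3)ˣ) : ZMod 3) • J) ∧
      ∀ M : Matrix (Fin 4) (Fin 4) (ZMod 3),
        (∃ c : (ZMod 3)ˣ, Mᵀ * J * M = (c : ZMod 3) • J) →
          ∃ σ : absoluteGaloisGroup ℚ, (C.rho σ).val = M)
    (hsepL : ((lPolynomialOfSurface 3 C.a₃ C.b₃).map (Int.castRingHom ℚ)).Separable) :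
    ∀ (p : ℕ) [Fact p.Prime] (b : Module.Basis (Fin 4) ℚ_[p] (A.rationalTateModule p))
      (r : FramedGaloisRep ℚ (PadicAlgCl p) 4),
      (∀ g : absoluteGaloisGroup ℚ,
        (r g).val =
          ((LinearMap.toMatrix b b (A.rationalTateRep p g⁻¹)).map
            (algebraMap ℚ_[p] (PadicAlgCl p))).transpose) →
      ∀ (hcpt : isCompact_glFiniteIntegralLevel 4 ℚ) (ι : PadicAlgCl p ≃+* ℂ),
        IsAutomorphicAE ι hcpt r := by
  intro p _ b r hr hcpt ι
  obtain ⟨e₃, he₃⟩ := C.frame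
  have hframe' : ∀ (σ : absoluteGaloisGroup ℚ) (P : A.geomTorsion (3 : ℕ)),
      e₃ (σ • P) = ((FramedRep.dual C.rho σ : GL (Fin 4) (ZMod 3)) :
        Matrix (Fin 4) (Fin 4) (ZMod 3)) *ᵥ e₃ P := by
    intro σ P
    rw [he₃, FramedRep.coe_dual_apply, map_inv]
  exact h111 A hA (FramedRep.dual C.rho) e₃ C.rho hframe' (FramedRep.dual_dual C.rho) hsurj
    (fun v hv => ⟨C.unramifiedAt_two v hv, C.frobCharpoly_two v hv⟩) C.ordinary_three
    (fun ℓ _ hℓ b' r' hr' v hv =>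
      separable_dualFrame_of_hasGoodEulerFactorAt C.euler_three
        (coeff_zero_lPolynomialOfSurface_map_ne_zero 3 _ _) hsepL ℓ hℓ b' r' hr' v hv)
    p b r hr hcpt ι

/-- Numeric form of DIST0(3) in `T`-form: `L₃(T) = 1 − aT + bT² − 3aT³ + 9T⁴` is separable over `ℚ`
as soon as a Bézout pair `u L₃ + v L₃' = 1` is exhibited (definition of `Polynomial.Separable`).
[folklore] -/
theorem separable_lPolynomial_of_bezout (a b : ℤ) (u v : Polynomial ℚ)
    (h : u * (lPolynomialOfSurface 3 a b).map (Int.castRingHom ℚ) +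
      v * Polynomial.derivative ((lPolynomialOfSurface 3 a b).map (Int.castRingHom ℚ)) = 1) :
    ((lPolynomialOfSurface 3 a b).map (Int.castRingHom ℚ)).Separable :=
  ⟨u, v, h⟩

end Summit.Ventures.ResidMod

end
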